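import Summits.ResolutionOfSingularities.ResolutionOfSingularities.Theorems.WeightedInvariantIota3FlagDeltaBridgeTranslate
import Mathlib.RingTheory.PowerSeries.WeierstrassPreparation
import HarnessLib

/-!
# R10b FLAG–δ BRIDGE (PART 4, end of the port): THE FIRST-MEMBER CLAUSE BY WEIERSTRASS PREPARATION —
# `first_member_mem_of_flag_reaches` (idea-2's §3g): in `S₀⟦X⟧`, `S₀` complete Noetherian local, the hub flag `(X; C u₁)` dominates EVERY
# reaching flag `(g₁; C u₁)` whose first member has `X`-order one

**Provenance / honest framing** — as in PART 1 (`…Iota3FlagDeltaBridgeDefs`): VERBATIM PORT of res-L1-w43-idea-2's §3g = `section Weierstrass` of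
`L/res-L1-w43-idea-2/Sketch-R10c.lean` (the rev-5 delta 0c7a9e209f05d872 over the frozen rev 4; later sections of R10c are NOT ported — port ceiling =
rev 5 per res-L1-w43-plan-1 WORD 2026-08-27T21:27:21Z), namespace `…LocalEngine.Iota3` (from `…Iota3.JCanCensus`), door `stmt-ResolutionOfSingularities-19897`
(candidate input for the FIRST-MEMBER clause of SPEC (Δ12) rev 4 l.223; consumer res-D-brk-1 decides use), ported by res-L1-type-o4,
`--supports stmt-ResolutionOfSingularities-19897 --as helper`. [OURS · L1 w43 · idea-2 R10b §3g] OURS elementary commutative algebra over Mathlib's Weierstrass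
preparation (`PowerSeries.exists_isWeierstrassFactorization`) and PARTS 1–3; NOT a statement of H. Hironaka's 2017 manuscript (nothing of it asserted or
used); no Literature fact introduced; AI-written/ported, weaker than expert review; no progress claim. Def-free.

## Contents (verbatim)
`flagContactFiltration_mul_unit` (the two-flag filtration sees the first member only up to units), `natDegree_eq_one_of_isWeierstrassFactorization`
(a Weierstrass factor of a series of `X`-order one has degree one), **`first_member_mem_of_flag_reaches`**: `S₀` Noetherian local, `𝔪₀`-adically complete,
`𝔪₀ = (u₀,u₁)` with (H); `h` monic Hironaka-minimal; `(q; r₁, r₂)` admissible; for every `g₁ : S₀⟦X⟧` with `g₁(0) ∈ 𝔪₀`, `∂g₁/∂X(0) ∉ 𝔪₀`: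
`↑h ∈ F_(g₁; C u₁)(r₁ ν) → g₁ ∈ F_(X; C u₁)(r₁)`.
-/

noncomputable section

open Polynomial IsLocalRing
open Literature.AlgebraicGeometry.Resolution.CossartPiltant
open Summit.ResolutionOfSingularities.ResolutionOfSingularities.Theorems

set_option linter.dupNamespace false

namespace Summit.ResolutionOfSingularities.ResolutionOfSingularities.Cruxes.HypersurfaceCentreConstruction.LocalEngine.Iota3

section Weierstrass

variable {S₀ : Type*} [CommRing S₀] [IsLocalRing S₀]

/-- The two-flag filtration only sees the first member up to units. [folklore] -/
theorem flagContactFiltration_mul_unit (g₁ g₂ v : PowerSeries S₀) (hv : IsUnit v) (q r₁ r₂ n : ℕ) :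
    flagContactFiltration (g₁ * v) g₂ q r₁ r₂ n = flagContactFiltration g₁ g₂ q r₁ r₂ n := by
  rw [flagContactFiltration_def, flagContactFiltration_def]
  refine iSup_congr fun a => iSup_congr fun b => ?_
  rw [show (g₁ * v) ^ a * g₂ ^ b = v ^ a * (g₁ ^ a * g₂ ^ b) by ring, Ideal.span_singleton_mul_left_unit (hv.pow a)]

/-- A Weierstrass factor of a power series of `X`-order one (`g(0) ∈ 𝔪₀`, `g'(0) ∉ 𝔪₀`) has degree one. [OURS · R10b §3g · bookkeeping] -/
theorem natDegree_eq_one_of_isWeierstrassFactorization {g : PowerSeries S₀} {f : S₀[X]} {v : PowerSeries S₀}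
    (hW : g.IsWeierstrassFactorization f v) (hg0 : PowerSeries.constantCoeff g ∈ maximalIdeal S₀)
    (hg1 : PowerSeries.coeff 1 g ∉ maximalIdeal S₀) : f.natDegree = 1 := by
  have hmon := hW.isDistinguishedAt.monic
  have hvu : IsUnit (PowerSeries.constantCoeff v) := PowerSeries.isUnit_iff_constantCoeff.mp hW.isUnit
  rcases Nat.lt_or_ge f.natDegree 1 with hd | hd
  · -- degree 0: `f = 1`, so `g = v` is a unit
    exfalso
    have hf1 : f = 1 := Polynomial.eq_one_of_monic_natDegree_zero hmon (by omega)
    have : IsUnit (PowerSeries.constantCoeff g) := by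
      rw [hW.eq_mul, hf1]; simpa using hvu
    exact (IsLocalRing.mem_maximalIdeal _ |>.mp hg0) this
  rcases hd.eq_or_lt with hd1 | hd2
  · exact hd1.symm
  · -- degree ≥ 2: `f₀, f₁ ∈ 𝔪₀` force `coeff 1 g ∈ 𝔪₀`
    exfalso
    have hf0 : f.coeff 0 ∈ maximalIdeal S₀ := hW.isDistinguishedAt.mem (by omega)
    have hf1 : f.coeff 1 ∈ maximalIdeal S₀ := hW.isDistinguishedAt.mem (by omega)
    apply hg1
    have h01 : (Finset.HasAntidiagonal.antidiagonal 1 : Finset (ℕ × ℕ)) = {((0 : ℕ), (1 : ℕ)), (1, 0)} := by decide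
    rw [hW.eq_mul, PowerSeries.coeff_mul, h01, Finset.sum_pair (by decide)]
    simp only [Polynomial.coeff_coe]
    exact Ideal.add_mem _ (Ideal.mul_mem_right _ _ hf0) (Ideal.mul_mem_right _ _ hf1)

/-- **§3g EVERY FIRST MEMBER OF `X`-ORDER ONE (R10b · OURS · PROVED; `S₀` complete)**.  With `S₀` Noetherian local and `𝔪_{S₀}`-adically
complete (Weierstrass preparation, Mathlib `PowerSeries.exists_isWeierstrassFactorization`), §3f upgrades from translates `X − C φ` to EVERY
first member `g₁ ∈ S₀⟦X⟧` with `g₁(0) ∈ 𝔪_{S₀}` and `∂g₁/∂X (0) ∉ 𝔪_{S₀}` (i.e. `g₁ = unit · (X − C φ)`): if the flag `(g₁; C u₁)` reaches the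
hub germ `h` at level `r₁ ν`, then `g₁ ∈ F_{(X; C u₁)}(r₁)` — the hub flag dominates it (first-member clause of SPEC (Δ12) rev 4 l.223; the
second members coincide).  What is still NOT covered: competing flags with ANOTHER second member, and first members with `∂g₁/∂X(0) ∈ 𝔪_{S₀}`
(linear part inside `(x, g₂)`).  [OURS · R10b §3g · PROVED · not expert-reviewed] -/
theorem first_member_mem_of_flag_reaches [IsNoetherianRing S₀] [IsAdicComplete (maximalIdeal S₀) S₀] (u : Fin 2 → S₀)
    (hm : maximalIdeal S₀ = Ideal.span (Set.range u))
    (H : ∀ (i : Fin 2) (T : Finset (Fin 2)), i ∉ T →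
      ∀ y, u i * y ∈ Ideal.span (u '' ↑T) → y ∈ Ideal.span (u '' ↑T))
    (hrad : (Ideal.span (Set.range u)).IsRadical)
    {h : S₀[X]} (hh : h.Monic) (hm1 : 1 ≤ h.natDegree) (hmin : IsMinimal u h)
    {q r₁ r₂ : ℕ} (hadm : AdmissibleTriple q r₁ r₂) {g₁ : PowerSeries S₀}
    (hg0 : PowerSeries.constantCoeff g₁ ∈ maximalIdeal S₀) (hg1 : PowerSeries.coeff 1 g₁ ∉ maximalIdeal S₀)
    (hreach : (h : PowerSeries S₀) ∈
      flagContactFiltration g₁ (PowerSeries.C (u 1)) q r₁ r₂ (r₁ * h.natDegree)) :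
    g₁ ∈ flagContactFiltration (PowerSeries.X : PowerSeries S₀) (PowerSeries.C (u 1)) q r₁ r₂ r₁ := by
  have hg : g₁.map (IsLocalRing.residue S₀) ≠ 0 := by
    intro h0
    apply hg1
    have := congrArg (PowerSeries.coeff 1) h0
    rw [PowerSeries.coeff_map, map_zero] at this
    exact (IsLocalRing.residue_eq_zero_iff _).mp this
  obtain ⟨f, v, hW⟩ := PowerSeries.exists_isWeierstrassFactorization hg
  have hd := natDegree_eq_one_of_isWeierstrassFactorization hW hg0 hg1
  set φ : S₀ := - f.coeff 0 with hφdef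
  have hφ : φ ∈ maximalIdeal S₀ := (maximalIdeal S₀).neg_mem (hW.isDistinguishedAt.mem (by omega))
  have hf : (f : PowerSeries S₀) = PowerSeries.X - PowerSeries.C φ := by
    have := Polynomial.Monic.eq_X_add_C hW.isDistinguishedAt.monic hd
    rw [this, hφdef]
    simp [Polynomial.coe_C, Polynomial.coe_X]
  have hreach' : (h : PowerSeries S₀) ∈ flagContactFiltration (PowerSeries.X - PowerSeries.C φ : PowerSeries S₀)
      (PowerSeries.C (u 1)) q r₁ r₂ (r₁ * h.natDegree) := by
    rw [hW.eq_mul, flagContactFiltration_mul_unit _ _ _ hW.isUnit, hf] at hreach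
    exact hreach
  have hmem := translate_first_member_mem u hm H hrad hh hm1 hmin hadm hφ hreach'
  rw [hW.eq_mul, hf]
  exact Ideal.mul_mem_right _ _ hmem

end Weierstrass
end Summit.ResolutionOfSingularities.ResolutionOfSingularities.Cruxes.HypersurfaceCentreConstruction.LocalEngine.Iota3
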